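import Literature.NumberTheory.EllipticCurves.BarriosEtAl2025.QuadraticTwistAtTwo
import Literature.NumberTheory.EllipticCurves.QuadraticTwistTateFormTwoProofs
import Literature.NumberTheory.EllipticCurves.QuadraticTwistLocalDataAtTwoPadicGlueProofs
import Literature.NumberTheory.EllipticCurves.MultiplicativeReductionJValuationProofs
import Literature.NumberTheory.DiophantineGeometry.ConductorRingOfIntegersProofs
import Literature.NumberTheory.DiophantineGeometry.ConductorExponentZeroProofs
import Literature.NumberTheory.DiophantineGeometry.ConductorMultiplicativeProofs
import HarnessLib

/-!
# Discharge of `BarriosEtAl2025.conductorExponent_quadraticTwist_two_of_le_one`: the conductor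
# exponent at `2` of a ramified quadratic twist of an elliptic curve semistable at `2`

`Proofs` file (theorems only: no definition, no named fact, no instance) in topic
`NumberTheory/EllipticCurves`, sibling of the statement file `BarriosEtAl2025/QuadraticTwistAtTwo`.
It proves the named fact
`Literature.NumberTheory.EllipticCurves.BarriosEtAl2025.conductorExponent_quadraticTwist_two_of_le_one`
(Barrios–Roy–Sahajpal–Tallana–Tobin–Wiersema, *Local data of elliptic curves under quadratic
twist*, Res. Number Theory **11** (2025), Thm. 5.1, rows `R = I₀` and `R = I_{n>0}` of the two
`ℚ₂` tables, column `(f, f^d)`, arXiv:2501.03209 pp. 15–16): for `W/ℚ` elliptic with conductor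
exponent `f₂(W) ≤ 1` and `d ∈ ℤ`, `f₂(W^{(d)}) = 4` if `d ≡ 3 (mod 4)` and `f₂(W^{(d)}) = 6` if
`d ≡ 2 (mod 4)`.

## The proof (assembly of the tree's Tate-algorithm runs at `2`; Silverman *ATAEC* IV.9.4, IV.11.1)

Everything is read at the place `v` of `𝓞 ℚ` above `2` and moved to the place of `ℤ` by
`WeierstrassCurve.conductorExponent_eq_of_primesEquiv_eq`.  `f_v(W) ≤ 1` splits by the local
trichotomy (`conductorExponent_eq_zero_iff_holds`, `conductorExponent_eq_one_iff_holds`):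

* **`W` multiplicative at `2`** (row `I_{n>0}`; then `ord₂ j(W) = -ν < 0`,
  `valuation_j_eq_exp_ordMinimalDiscriminant_of_hasMultiplicativeReductionAt`).  By
  `exists_int_variableChange_eq_quadraticTwist_tateFormOfJ`, `W ≅ T^{(d₀)}` over `ℚ` with
  `T = tateFormOfJ j(W)` and `4 ∤ d₀`; `d₀ ≡ 2, 3 (mod 4)` would give `f₂(W) = 6, 4`
  (`conductorExponent_eq_six_of_emod_four_eq_two`, `conductorExponent_eq_four_of_emod_four_eq_three`
  of `QuadraticTwistTateFormTwoProofs`, families B/A of `TateAlgorithmIstarCharTwoProofs`), so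
  `d₀ ≡ 1 (mod 4)`; then `W^{(d)} ≅ T^{(d₀d)}` (`quadraticTwist_smul`, `quadraticTwist_quadraticTwist`,
  `j_quadraticTwist`) with `d₀d ≡ d (mod 4)`, and the same two theorems give `f₂(W^{(d)}) = 4`
  (type `I*_{ν+4}`, `ord₂ Δ_min = ν + 12`) for `d ≡ 3` and `= 6` (type `I*_{ν+8}`,
  `ord₂ Δ_min = ν + 18`) for `d ≡ 2 (mod 4)`.
* **`W` good at `2`** (row `I₀`).  The integral local minimal model has unit discriminant and is
  brought to the ordinary (`a₁ = 1, a₃ = 0, 4 ∣ a₄`) or supersingular (`a₁ = 0`) normal form of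
  `QuadraticTwistGoodReductionCharTwoProofs` over `O_v`; the explicit `O_v`-models of the twist
  of that file and of `QuadraticTwistGoodReductionCharTwoSupersingularProofs` have Kodaira symbol
  and discriminant valuation `(I₄*, 12)`, `(II*, 12)` for `d ≡ 3 (mod 4)` and `(I₈*, 18)`,
  `(II, 6)` for `d ≡ 2 (mod 4)`; they are minimal because Tate's algorithm does not return `I₀`
  on them (`isMinimal_baseChange_of_kodairaSymbolOfMinimal_ne_I_zero`), so `kodairaSymbolAt` and
  `ordMinimalDiscriminant` of `W^{(d)}` are read on them
  (`kodairaSymbolAt_eq_kodairaSymbolOfMinimal_of_isMinimal`, `ordMinimalDiscriminant_eq_of_isMinimal`)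
  and Ogg's formula `f = ord Δ_min + 1 - m` (the definition of `conductorExponent`) gives
  `12 + 1 - 9 = 4` and `18 + 1 - 13 = 6 + 1 - 1 = 6`.

## Main result

* `Literature.NumberTheory.EllipticCurves.BarriosEtAl2025.conductorExponent_quadraticTwist_two_of_le_one_holds`.

## References

* A. J. Barrios, M. Roy, N. Sahajpal, D. Tallana, B. Tobin, H. Wiersema, *Local data of elliptic
  curves under quadratic twist*, Res. Number Theory 11 (2025), no. 3, Thm. 5.1 with Tables
  tab:localdata-dodd / tab:localdata-deven, rows `R = I₀`, `R = I_{n>0}`, column `(f, f^d)`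
  (arXiv:2501.03209 pp. 15–16). [BarriosEtAl2025]
* J. H. Silverman, *Advanced Topics in the Arithmetic of Elliptic Curves*, GTM 151 (1994), IV.9.4
  (Tate's algorithm), Table 4.1, IV.11.1 (Ogg's formula). [SilvermanATAEC1994]
* J. H. Silverman, *The Arithmetic of Elliptic Curves*, 2nd ed. (2009), VII.1 Prop. 1.3, VII.5
  Prop. 5.1, X.5 Cor. 5.4. [SilvermanAEC2009]
-/

noncomputable section

open scoped Classical NumberField

open IsDedekindDomain IsLocalRing Rat.HeightOneSpectrum
  Literature.NumberTheory.DiophantineGeometry Literature.NumberTheory.DiophantineGeometry.TateAlgorithm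
  Literature.NumberTheory.EllipticCurves Literature.NumberTheory.EllipticCurves.TwistGoodTwo
open IsDiscreteValuationRing hiding maximalIdeal

namespace Literature.NumberTheory.EllipticCurves.BarriosEtAl2025

namespace ConductorTwistTwo

/-! ### Generic transport lemmas -/

/-- `(W^{(d)}) ⊗ L = (W ⊗ L)^{(f d)}` for a ring map `f` of fields (the twist model has
coefficients `0, d b₂/4, 0, d² b₄/2, d³ b₆/4`). Silverman *AEC* X.5 Cor. 5.4. [folklore] -/
private theorem map_quadraticTwist {F L : Type*} [Field F] [Field L] (W : WeierstrassCurve F)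
    (f : F →+* L) (d : F) :
    (W.quadraticTwist d).map f = (W.map f).quadraticTwist (f d) := by
  ext
  · simp
  · simp [map_div₀, map_ofNat]
  · simp
  · simp [map_div₀, map_ofNat]
  · simp [map_div₀, map_ofNat]

/-- Transport of a model identity along `C₁ • E = V ⊗ K`: a change of variables taking
`(V ⊗ K)^{(d)}` to `M ⊗ K` yields one taking `E^{(d)}` to `M ⊗ K` (`quadraticTwist_smul`).
Silverman *AEC* X.5 Cor. 5.4. [folklore] -/
private theorem exists_smul_quadraticTwist_eq_baseChange {R K : Type*} [CommRing R] [Field K]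
    [NeZero (2 : K)] [Algebra R K] (E : WeierstrassCurve K) (V M : WeierstrassCurve R)
    (C₁ : WeierstrassCurve.VariableChange K) (hVE : C₁ • E = V.baseChange K) (d : K)
    (hM : ∃ C : WeierstrassCurve.VariableChange K,
      C • ((V.baseChange K).quadraticTwist d) = M.baseChange K) :
    ∃ C : WeierstrassCurve.VariableChange K, C • (E.quadraticTwist d) = M.baseChange K := by
  obtain ⟨C, hC⟩ := hM
  refine ⟨C * ⟨C₁.u, d * C₁.r, 0, 0⟩, ?_⟩
  rw [mul_smul, ← WeierstrassCurve.quadraticTwist_smul, hVE, hC]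

/-! ### Reading `f_v` on an explicit `O_v`-model where Tate's algorithm exits -/

section Place

variable (v : HeightOneSpectrum (𝓞 ℚ))

/-- **`kodairaSymbolAt` and `ord_v Δ_min` read on an explicit `O_v`-model.**  If `C • (X ⊗ ℚ_v) =
M ⊗ ℚ_v` with `M` over `O_v` and Tate's algorithm run literally on `M` does not return `I₀`, then
`M ⊗ ℚ_v` is minimal (`isMinimal_baseChange_of_kodairaSymbolOfMinimal_ne_I_zero`), so the Kodaira
symbol of `X` at `v` is `kodairaSymbolOfMinimal M` and `ord_v Δ_min(X) = ord_v Δ(M)`.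
Silverman *ATAEC* IV.9.4; *AEC* VII.1 Prop. 1.3(b).
[cite: SilvermanATAEC1994, IV.9.4 (PDF pp. 344–346)] [cite: SilvermanAEC2009, VII.1 Prop. 1.3(b)] -/
theorem kodairaSymbolAt_and_ordMinimalDiscriminant_of_model (X : WeierstrassCurve ℚ) [X.IsElliptic]
    (M : WeierstrassCurve (v.adicCompletionIntegers ℚ))
    (C : WeierstrassCurve.VariableChange (v.adicCompletion ℚ))
    (h : C • X.baseChange (v.adicCompletion ℚ) = M.baseChange (v.adicCompletion ℚ))
    (hM : M.kodairaSymbolOfMinimal ≠ .I 0) :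
    X.kodairaSymbolAt v = M.kodairaSymbolOfMinimal ∧
      X.ordMinimalDiscriminant v =
        (addVal (v.adicCompletionIntegers ℚ) M.Δ).toNat := by
  haveI hmin : (M.baseChange (v.adicCompletion ℚ)).IsMinimal (v.adicCompletionIntegers ℚ) :=
    WeierstrassCurve.isMinimal_baseChange_of_kodairaSymbolOfMinimal_ne_I_zero M hM
  haveI : (X.baseChange (v.adicCompletion ℚ)).IsElliptic := by
    rw [WeierstrassCurve.baseChange]; infer_instance
  have hΔ : (M.baseChange (v.adicCompletion ℚ)).Δ ≠ 0 := by
    rw [← h]; exact (C • X.baseChange (v.adicCompletion ℚ)).isUnit_Δ.ne_zero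
  have hint : (M.baseChange (v.adicCompletion ℚ)).integralModel (v.adicCompletionIntegers ℚ) = M :=
    WeierstrassCurve.integralModel_baseChange_eq (v.adicCompletionIntegers ℚ) M
  refine ⟨?_, ?_⟩
  · rw [X.kodairaSymbolAt_eq_kodairaSymbolOfMinimal_of_isMinimal v (M.baseChange _) C h.symm hΔ,
      hint]
  · rw [X.ordMinimalDiscriminant_eq_of_isMinimal v (M.baseChange _) C h.symm hΔ, hint]

/-- **Ogg's formula read on an explicit model**: under the same hypotheses,
`f_v(X) = ord_v Δ(M) + 1 - m(kodairaSymbolOfMinimal M)`. Silverman *ATAEC* IV.11.1.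
[cite: SilvermanATAEC1994, IV.11.1 (Ogg's formula)] -/
theorem conductorExponent_of_model (X : WeierstrassCurve ℚ) [X.IsElliptic]
    (M : WeierstrassCurve (v.adicCompletionIntegers ℚ))
    (C : WeierstrassCurve.VariableChange (v.adicCompletion ℚ))
    (h : C • X.baseChange (v.adicCompletion ℚ) = M.baseChange (v.adicCompletion ℚ))
    (hM : M.kodairaSymbolOfMinimal ≠ .I 0) :
    X.conductorExponent v =
      (addVal (v.adicCompletionIntegers ℚ) M.Δ).toNat + 1 - M.kodairaSymbolOfMinimal.numComponents := by
  obtain ⟨hK, hΔ⟩ := kodairaSymbolAt_and_ordMinimalDiscriminant_of_model v X M C h hM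
  unfold WeierstrassCurve.conductorExponent WeierstrassCurve.numComponentsAt
  rw [hK, hΔ]

/-! ### Row `I₀`: `W` with good reduction at `2` -/

/-- The integral local minimal model of a curve with good reduction at `v ∋ 2`, brought into one
of the two normal forms of `QuadraticTwistGoodReductionCharTwoProofs`: an `O_v`-model `V` of
`W ⊗ ℚ_v` with unit discriminant and either `a₁ = 1, a₃ = 0, 4 ∣ a₄` (ordinary) or `a₁ = 0`
(supersingular). Silverman *AEC* VII.1, III.1 Table 3.1. [folklore] -/
private theorem exists_normalForm_of_hasGoodReductionAt {ε : v.adicCompletionIntegers ℚ}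
    (hε : (2 : v.adicCompletionIntegers ℚ) = uniformizer (v.adicCompletionIntegers ℚ) * ε)
    (hεu : IsUnit ε) (W : WeierstrassCurve ℚ) [W.IsElliptic] (hgood : W.HasGoodReductionAt v) :
    ∃ (V : WeierstrassCurve (v.adicCompletionIntegers ℚ))
      (C₁ : WeierstrassCurve.VariableChange (v.adicCompletion ℚ)),
      C₁ • W.baseChange (v.adicCompletion ℚ) = V.baseChange (v.adicCompletion ℚ) ∧ IsUnit V.Δ ∧
        ((V.a₁ = 1 ∧ V.a₃ = 0 ∧ (4 : v.adicCompletionIntegers ℚ) ∣ V.a₄) ∨ V.a₁ = 0) := by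
  set O := v.adicCompletionIntegers ℚ
  set K := v.adicCompletion ℚ
  set E : WeierstrassCurve K := W.baseChange K with hE
  haveI hg : (E.minimal O).HasGoodReduction O := hgood
  set I := (E.minimal O).integralModel O with hIdef
  have hI : I.baseChange K = (E.exists_isMinimal O).choose • E :=
    WeierstrassCurve.baseChange_integralModel_eq O (E.minimal O)
  have hΔI : IsUnit I.Δ := isUnit_Δ_integralModel_of_hasGoodReduction (E.minimal O)
  have key : ∀ D : WeierstrassCurve.VariableChange O,
      (D.map (algebraMap O K) * (E.exists_isMinimal O).choose) • E = (D • I).baseChange K ∧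
        IsUnit (D • I).Δ := fun D ↦ by
    refine ⟨?_, ?_⟩
    · rw [mul_smul, ← hI, WeierstrassCurve.baseChange, WeierstrassCurve.baseChange,
        WeierstrassCurve.map_variableChange]
    · rw [WeierstrassCurve.variableChange_Δ]
      exact ((D.u⁻¹).isUnit.pow 12).mul hΔI
  by_cases ha : IsUnit I.a₁
  · obtain ⟨D, h1, h3, h4⟩ := exists_smul_ordinaryNormalForm I ha
    exact ⟨D • I, _, (key D).1, (key D).2, Or.inl ⟨h1, h3, h4⟩⟩
  · have hdvd : uniformizer O ∣ I.a₁ := (not_isUnit_iff_dvd irreducible_uniformizer _).mp ha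
    obtain ⟨D, -, h1⟩ := exists_smul_a₁_eq_zero hε hεu I hdvd
    exact ⟨D • I, _, (key D).1, (key D).2, Or.inr h1⟩

/-- **Row `I₀` of the two tables, column `(f, f^d)`**: for `W/ℚ` with good reduction at the place
`v ∋ 2`, `f_v(W^{(d)}) = 4` if `d ≡ 3 (mod 4)` (types `I₄*`/`II*`, `ord Δ_min = 12`) and
`f_v(W^{(d)}) = 6` if `d ≡ 2 (mod 4)` (types `I₈*`, `ord Δ_min = 18` / `II`, `ord Δ_min = 6`),
by Tate's algorithm on the explicit minimal models of `QuadraticTwistGoodReductionCharTwoProofs`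
/ `…SupersingularProofs` and Ogg's formula.  Barrios et al. 2025, Thm. 5.1, rows `R = I₀`.
[cite: BarriosEtAl2025, Thm. 5.1, §5 tables v(d) = 0 / v(d) = 1, rows I₀, column (f, f^d) (arXiv pp. 15–16)]
[cite: SilvermanATAEC1994, IV.9.4 and IV.11.1] -/
theorem conductorExponent_quadraticTwist_of_hasGoodReductionAt (hv : natGenerator v = 2)
    (W : WeierstrassCurve ℚ) [W.IsElliptic] (hgood : W.HasGoodReductionAt v) (d : ℤ) :
    (d % 4 = 3 → (W.quadraticTwist (d : ℚ)).conductorExponent v = 4) ∧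
      (d % 4 = 2 → (W.quadraticTwist (d : ℚ)).conductorExponent v = 6) := by
  set O := v.adicCompletionIntegers ℚ
  set K := v.adicCompletion ℚ
  obtain ⟨ε, hεu, hε⟩ := WeierstrassCurve.exists_isUnit_two_eq_uniformizer_mul v hv
  obtain ⟨V, C₁, hVE, hVΔ, hform⟩ := exists_normalForm_of_hasGoodReductionAt v hε hεu W hgood
  -- `2 ≠ 0` in `ℚ_v` (needed by `quadraticTwist_smul`)
  haveI : NeZero (2 : K) := by
    refine ⟨fun h20 ↦ ?_⟩
    have h2O : (2 : O) ≠ 0 := by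
      rw [hε]; exact mul_ne_zero irreducible_uniformizer.ne_zero hεu.ne_zero
    apply h2O
    apply IsFractionRing.injective O K
    rw [map_ofNat, map_zero]
    exact h20
  -- the twist over `ℚ` base-changed to `ℚ_v` is the twist of the base change
  have htw : ∀ {d : ℤ}, (d : ℚ) ≠ 0 →
      (W.quadraticTwist (d : ℚ)).baseChange K = (W.baseChange K).quadraticTwist (d : K) := by
    intro d _
    rw [WeierstrassCurve.baseChange, WeierstrassCurve.baseChange, map_quadraticTwist, map_intCast]
  refine ⟨fun hd3 ↦ ?_, fun hd2 ↦ ?_⟩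
  · -- `d ≡ 3 (mod 4)`
    obtain ⟨k, hk⟩ : ∃ k : ℤ, d = 4 * k + 3 := ⟨d / 4, by omega⟩
    have hd0 : (d : ℚ) ≠ 0 := by exact_mod_cast (show (d : ℤ) ≠ 0 by omega)
    haveI := W.isElliptic_quadraticTwist hd0
    rcases hform with ⟨h1, h3, h4⟩ | h1
    · obtain ⟨hK, hΔ, -⟩ := kodairaSymbolOfMinimal_twistGoodOrdinary_three hε hεu V h1 h3 h4 hVΔ hk
      obtain ⟨C, hC⟩ := exists_smul_quadraticTwist_eq_baseChange (W.baseChange K) V _ C₁ hVE (d : K)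
        (smul_quadraticTwist_eq_modelThree hε hεu V h1 h3 d)
      rw [← htw hd0] at hC
      rw [conductorExponent_of_model v _ _ C hC (by rw [hK]; decide), hK, hΔ]
      rfl
    · obtain ⟨hK, hΔ, -⟩ := kodairaSymbolOfMinimal_twistGoodSupersingular_three hε hεu V h1 hVΔ hk
      obtain ⟨C, hC⟩ := exists_smul_quadraticTwist_eq_baseChange (W.baseChange K) V _ C₁ hVE (d : K)
        (smul_quadraticTwist_eq_modelThree' hε hεu V h1 d)
      rw [← htw hd0] at hC
      rw [conductorExponent_of_model v _ _ C hC (by rw [hK]; decide), hK, hΔ]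
      rfl
  · -- `d ≡ 2 (mod 4)`
    obtain ⟨k, hk⟩ : ∃ k : ℤ, d = 4 * k + 2 := ⟨d / 4, by omega⟩
    have hd0 : (d : ℚ) ≠ 0 := by exact_mod_cast (show (d : ℤ) ≠ 0 by omega)
    haveI := W.isElliptic_quadraticTwist hd0
    rcases hform with ⟨h1, h3, h4⟩ | h1
    · obtain ⟨hK, hΔ, -⟩ := kodairaSymbolOfMinimal_twistGoodOrdinary_two hε hεu V h1 h3 h4 hVΔ hk
      obtain ⟨C, hC⟩ := exists_smul_quadraticTwist_eq_baseChange (W.baseChange K) V _ C₁ hVE (d : K)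
        (smul_quadraticTwist_eq_modelTwo hε hεu V h1 h3 d)
      rw [← htw hd0] at hC
      rw [conductorExponent_of_model v _ _ C hC (by rw [hK]; decide), hK, hΔ]
      rfl
    · have hd₁ : (2 * k + 1 : ℤ) = 2 * k + 1 := rfl
      obtain ⟨hK, hΔ, -⟩ := kodairaSymbolOfMinimal_twistGoodSupersingular_two hε hεu V h1 hVΔ hd₁
      have hdd : ((d : ℤ) : K) = ((2 * (2 * k + 1) : ℤ) : K) := by
        congr 1; omega
      obtain ⟨C, hC⟩ := exists_smul_quadraticTwist_eq_baseChange (W.baseChange K) V _ C₁ hVE (d : K)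
        ⟨1, by rw [one_smul, hdd]; exact quadraticTwist_eq_modelTwo' hε hεu V h1 (2 * k + 1)⟩
      rw [← htw hd0] at hC
      rw [conductorExponent_of_model v _ _ C hC (by rw [hK]; decide), hK, hΔ]
      rfl

/-! ### Row `I_{n>0}`: `W` with `ord₂ j < 0` -/

/-- **Rows `I_{n>0}`, column `(f, f^d)`**: for `W/ℚ` elliptic with `ord_v j(W) < 0` at the place
`v ∋ 2` and `f_v(W) ≤ 1`, `f_v(W^{(d)}) = 4` if `d ≡ 3 (mod 4)` (type `I*_{ν+4}`) and `= 6` if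
`d ≡ 2 (mod 4)` (type `I*_{ν+8}`): `W ≅ T^{(d₀)}` with `T` the Tate normal form of invariant
`j(W)` and `d₀ ≡ 1 (mod 4)` (the other classes are excluded by `f_v(W) ≤ 1`), and
`W^{(d)} ≅ T^{(d₀ d)}`.  Barrios et al. 2025, Thm. 5.1, rows `R = I_{n>0}`; the computation is
`QuadraticTwistTateFormTwoProofs` (families A/B of `TateAlgorithmIstarCharTwoProofs`).
[cite: BarriosEtAl2025, Thm. 5.1, §5 tables v(d) = 0 / v(d) = 1, rows I_{n>0}, column (f, f^d) (arXiv pp. 15–16)]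
[cite: SilvermanATAEC1994, IV.9.4 Step 7 and IV.11.1] -/
theorem conductorExponent_quadraticTwist_of_one_lt_valuation_j (hv : natGenerator v = 2)
    (W : WeierstrassCurve ℚ) [W.IsElliptic] (hj : 1 < v.valuation ℚ W.j)
    (hf : W.conductorExponent v ≤ 1) (d : ℤ) :
    (d % 4 = 3 → (W.quadraticTwist (d : ℚ)).conductorExponent v = 4) ∧
      (d % 4 = 2 → (W.quadraticTwist (d : ℚ)).conductorExponent v = 6) := by
  obtain ⟨hj0, hj1728, -⟩ := W.j_ne_and_valuation_j_sub_eq_of_one_lt_valuation_j v hj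
  obtain ⟨d₀, hd₀0, hd₀4, C, hC⟩ := W.exists_int_variableChange_eq_quadraticTwist_tateFormOfJ hj0 hj1728
  -- `f_v(W) ≤ 1` forces the unramified class `d₀ ≡ 1 (mod 4)`
  have hd₀1 : d₀ % 4 = 1 := by
    rcases (show d₀ % 4 = 1 ∨ d₀ % 4 = 2 ∨ d₀ % 4 = 3 by omega) with h | h | h
    · exact h
    · have h6 := (WeierstrassCurve.conductorExponent_eq_six_of_emod_four_eq_two v hv W hj h hC).1
      omega
    · have h4 := (WeierstrassCurve.conductorExponent_eq_four_of_emod_four_eq_three v hv W hj h hC).1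
      omega
  -- the twist `W^{(d)}` is `T^{(d₀ d)}`
  have key : ∀ {d : ℤ}, (d : ℚ) ≠ 0 → ∀ [(W.quadraticTwist (d : ℚ)).IsElliptic],
      1 < v.valuation ℚ (W.quadraticTwist (d : ℚ)).j ∧
        (⟨C.u, (d : ℚ) * C.r, 0, 0⟩ : WeierstrassCurve.VariableChange ℚ) • W.quadraticTwist (d : ℚ) =
          (tateFormOfJ (W.quadraticTwist (d : ℚ)).j).quadraticTwist ((d₀ * d : ℤ) : ℚ) := by
    intro d hd0 _
    have hjd : (W.quadraticTwist (d : ℚ)).j = W.j := W.j_quadraticTwist hd0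
    refine ⟨by rw [hjd]; exact hj, ?_⟩
    rw [hjd, ← WeierstrassCurve.quadraticTwist_smul, hC, WeierstrassCurve.quadraticTwist_quadraticTwist]
    push_cast
    ring_nf
  refine ⟨fun hd3 ↦ ?_, fun hd2 ↦ ?_⟩
  · have hd0 : (d : ℚ) ≠ 0 := by exact_mod_cast (show (d : ℤ) ≠ 0 by omega)
    haveI := W.isElliptic_quadraticTwist hd0
    obtain ⟨hj', hC'⟩ := key hd0
    have hd' : (d₀ * d) % 4 = 3 := by rw [Int.mul_emod, hd₀1, hd3]; norm_num
    exact (WeierstrassCurve.conductorExponent_eq_four_of_emod_four_eq_three v hv _ hj' hd' hC').1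
  · have hd0 : (d : ℚ) ≠ 0 := by exact_mod_cast (show (d : ℤ) ≠ 0 by omega)
    haveI := W.isElliptic_quadraticTwist hd0
    obtain ⟨hj', hC'⟩ := key hd0
    have hd' : (d₀ * d) % 4 = 2 := by rw [Int.mul_emod, hd₀1, hd2]; norm_num
    exact (WeierstrassCurve.conductorExponent_eq_six_of_emod_four_eq_two v hv _ hj' hd' hC').1

/-! ### Assembly at the place of `𝓞 ℚ` above `2` -/

/-- **Both rows at the place `v ∋ 2` of `𝓞 ℚ`**: for `W/ℚ` elliptic with `f_v(W) ≤ 1`,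
`f_v(W^{(d)}) = 4` for `d ≡ 3 (mod 4)` and `= 6` for `d ≡ 2 (mod 4)`.  `f_v ≤ 1` means good or
multiplicative reduction (`conductorExponent_eq_zero_iff_holds`, `conductorExponent_eq_one_iff_holds`;
additive reduction is excluded by the trichotomy), and multiplicative reduction gives
`ord_v j < 0`.  Barrios et al. 2025, Thm. 5.1.
[cite: BarriosEtAl2025, Thm. 5.1, rows I₀ / I_{n>0}, column (f, f^d) (arXiv pp. 15–16)] -/
theorem conductorExponent_quadraticTwist_of_le_one (hv : natGenerator v = 2)
    (W : WeierstrassCurve ℚ) [W.IsElliptic] (hf : W.conductorExponent v ≤ 1) (d : ℤ) :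
    (d % 4 = 3 → (W.quadraticTwist (d : ℚ)).conductorExponent v = 4) ∧
      (d % 4 = 2 → (W.quadraticTwist (d : ℚ)).conductorExponent v = 6) := by
  by_cases hj : 1 < v.valuation ℚ W.j
  · exact conductorExponent_quadraticTwist_of_one_lt_valuation_j v hv W hj hf d
  · refine conductorExponent_quadraticTwist_of_hasGoodReductionAt v hv W ?_ d
    rcases Nat.le_one_iff_eq_zero_or_eq_one.mp hf with h0 | h1
    · exact (WeierstrassCurve.conductorExponent_eq_zero_iff_holds v W).mp h0
    · exfalso
      apply hj
      have hmult : W.HasMultiplicativeReductionAt v :=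
        (WeierstrassCurve.conductorExponent_eq_one_iff_holds v W).mp h1
      rw [W.valuation_j_eq_exp_ordMinimalDiscriminant_of_hasMultiplicativeReductionAt v hmult,
        ← WithZero.exp_zero, WithZero.exp_lt_exp]
      have hne := W.ordMinimalDiscriminant_ne_zero_of_hasMultiplicativeReductionAt v hmult
      omega

end Place

end ConductorTwistTwo

/-! ### The discharge -/

/-- **Discharge of the named fact `BarriosEtAl2025.conductorExponent_quadraticTwist_two_of_le_one`**
(Barrios–Roy–Sahajpal–Tallana–Tobin–Wiersema 2025, Thm. 5.1, rows `R = I₀` and `R = I_{n>0}`,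
column `(f, f^d)`): for `W/ℚ` elliptic, `v` the place of `ℤ` above `2` with `f_v(W) ≤ 1`, and
`d : ℤ`, `d ≡ 3 (mod 4) ⟹ f_v(W^{(d)}) = 4` and `d ≡ 2 (mod 4) ⟹ f_v(W^{(d)}) = 6`.  The place of
`ℤ` is exchanged for the place of `𝓞 ℚ` above the same prime
(`WeierstrassCurve.conductorExponent_eq_of_primesEquiv_eq`), where
`ConductorTwistTwo.conductorExponent_quadraticTwist_of_le_one` applies.
[cite: BarriosEtAl2025, Thm. 5.1, Tables tab:localdata-dodd / tab:localdata-deven, rows R = I₀ and R = I_{n>0}, column (f, f^d) (arXiv:2501.03209 pp. 15–16)]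
[cite: SilvermanATAEC1994, IV.9.4 (Tate's algorithm) and IV.11.1 (Ogg's formula)] -/
theorem conductorExponent_quadraticTwist_two_of_le_one_holds :
    conductorExponent_quadraticTwist_two_of_le_one := by
  intro W _ v hv hf d
  set v' : HeightOneSpectrum (𝓞 ℚ) := (primesEquiv (R := 𝓞 ℚ)).symm (primesEquiv v) with hv'def
  have hvv : primesEquiv v = primesEquiv v' := ((primesEquiv (R := 𝓞 ℚ)).apply_symm_apply _).symm
  have hv' : natGenerator v' = 2 := by
    change ((primesEquiv v' : Nat.Primes) : ℕ) = 2
    rw [← hvv]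
    exact hv
  have hf' : W.conductorExponent v' ≤ 1 := by
    rwa [← WeierstrassCurve.conductorExponent_eq_of_primesEquiv_eq v v' W hvv]
  have key := ConductorTwistTwo.conductorExponent_quadraticTwist_of_le_one v' hv' W hf' d
  refine ⟨fun hd3 ↦ ?_, fun hd2 ↦ ?_⟩
  · have hd0 : (d : ℚ) ≠ 0 := by exact_mod_cast (show (d : ℤ) ≠ 0 by omega)
    haveI := W.isElliptic_quadraticTwist hd0
    rw [WeierstrassCurve.conductorExponent_eq_of_primesEquiv_eq v v' _ hvv]
    exact key.1 hd3
  · have hd0 : (d : ℚ) ≠ 0 := by exact_mod_cast (show (d : ℤ) ≠ 0 by omega)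
    haveI := W.isElliptic_quadraticTwist hd0
    rw [WeierstrassCurve.conductorExponent_eq_of_primesEquiv_eq v v' _ hvv]
    exact key.2 hd2

end Literature.NumberTheory.EllipticCurves.BarriosEtAl2025

end
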